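import Mathlib
import Literature.NumberTheory.GaloisRepresentations.HeckeCharacterArchTypeProofs
import Summits.Langlands.Langlands.Theorems.PicardMuOrdinaryResidualAutomorphyEvenCM

/-!
# Hecke characters of the cubic resolvent field `E` of even unitary archimedean type (Stage B1)

Helper file for item stmt-Langlands-13760 (route `PicardMuOrdinary`).  `E` is a CM field (`CM` file),
so **for every even `m : InfinitePlace E → ℤ` there is a unitary Hecke character `ψ` of `E` of unitary
archimedean type `(m, 0)`** (`exists_heckeCharacter_even_archType`, stated for any CM field, and
`exists_psi` for `E`), i.e. `ψ((x, 1)) = ∏_w (ι_w x_w / |ι_w x_w|)^{m_w}` on `E_∞ˣ` — by Weil's extension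
lemma in the form proved in the tree (`HeckeCharacter.exists_isUnitary_hasUnitaryArchType_of_congruence`:
it suffices that the archimedean product kills the units `u ≡ 1 mod 𝔞` for some `𝔞 ≠ 0`).  With
`𝔞 = (p)` for a rational prime `p` exceeding the number `N` of roots of unity: for a unit `u ≡ 1 mod p`
also `ū ≡ 1 mod p`, so the root of unity `ζ = u/ū` (CM field: Mathlib's
`IsCMField.unitsMulComplexConjInv`) is `≡ 1` modulo a prime `𝔓 ∣ p`, and `𝔓 ∌ N` (`gcd(p, N) = 1`),
hence `ζ = 1` (`0 = ζ^N - 1 = (ζ - 1)(1 + ⋯ + ζ^{N-1})`, second factor `≡ N`); thus `u = ū`, every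
`ι_w(u)` is real and `(ι_w u/|ι_w u|)^{m_w} = 1` for even `m_w`.  (With `m` a permutation of
`(2, 0, -2)`, `ψ` is the character for which `AI_{E/K}(ψ ε)` has the cohomological weight-`0`
archimedean exponents `{1, 0, -1}`; see the item notes.)  Unconditional.
-/

set_option linter.dupNamespace false -- project-wide option (lakefile weak.linter.dupNamespace); `Summit.Langlands.Langlands` is the mandated namespace

noncomputable section

namespace Summit.Langlands.Langlands.Theorems.ResidualAutomorphyEven

open Polynomial NumberField NumberField.Units
open Literature.NumberTheory.GaloisRepresentations
open scoped Classical ComplexConjugate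

/-! ### Roots of unity congruent to `1`; rational primes are not units -/

/-- **A root of unity `≡ 1` modulo a prime ideal not containing its order is `1`**:
`0 = ζⁿ - 1 = (ζ - 1)(1 + ζ + ⋯ + ζⁿ⁻¹)` and `1 + ζ + ⋯ + ζⁿ⁻¹ ≡ n ≢ 0 (mod 𝔓)`. -/
theorem eq_one_of_pow_eq_one_of_sub_one_mem {R : Type*} [CommRing R] [IsDomain R] {ζ : R} {n : ℕ}
    (hζ : ζ ^ n = 1) (𝔓 : Ideal R) [𝔓.IsPrime] (h1 : ζ - 1 ∈ 𝔓) (hn : (n : R) ∉ 𝔓) : ζ = 1 := by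
  have hgeom : (∑ i ∈ Finset.range n, ζ ^ i) * (ζ - 1) = 0 := by rw [geom_sum_mul, hζ, sub_self]
  -- `∑ ζ^i ≡ n (mod 𝔓)`
  have hsum : (∑ i ∈ Finset.range n, ζ ^ i) - n ∈ 𝔓 := by
    have : (∑ i ∈ Finset.range n, ζ ^ i) - n = ∑ i ∈ Finset.range n, (ζ ^ i - 1) := by
      rw [Finset.sum_sub_distrib, Finset.sum_const, Finset.card_range, nsmul_eq_mul, mul_one]
    rw [this]
    refine Ideal.sum_mem _ fun i _ => ?_
    have hdvd : ζ - 1 ∣ ζ ^ i - 1 := by simpa using sub_dvd_pow_sub_pow ζ 1 i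
    exact Ideal.mem_of_dvd _ hdvd h1
  have hS : (∑ i ∈ Finset.range n, ζ ^ i) ∉ 𝔓 := fun hS => hn (by simpa using 𝔓.sub_mem hS hsum)
  rcases mul_eq_zero.mp hgeom with h0 | h0
  · exact absurd (h0 ▸ 𝔓.zero_mem) hS
  · exact sub_eq_zero.mp h0

/-- A rational prime is not a unit of a ring of integers (`1/p` is not an algebraic integer). -/
theorem not_isUnit_natCast_ringOfIntegers {L : Type*} [Field L] [NumberField L] {p : ℕ} (hp : p.Prime) :
    ¬ IsUnit (p : 𝓞 L) := by
  intro hu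
  obtain ⟨b, hb⟩ := hu.exists_right_inv
  have h1 : (p : L) * (b : L) = 1 := by
    have := congrArg (fun x : 𝓞 L => (x : L)) hb
    simpa using this
  have hbL : (b : L) = algebraMap ℚ L ((p : ℚ)⁻¹) := by
    rw [map_inv₀, map_natCast]; exact eq_inv_of_mul_eq_one_right h1
  have hint : IsIntegral ℤ ((p : ℚ)⁻¹) := by
    have h : IsIntegral ℤ (b : L) := RingOfIntegers.isIntegral_coe b
    rwa [hbL, isIntegral_algebraMap_iff (algebraMap ℚ L).injective] at h
  obtain ⟨n, hn⟩ := (IsIntegrallyClosed.isIntegral_iff (R := ℤ) (K := ℚ)).mp hint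
  rw [eq_intCast] at hn
  have hp0 : (p : ℚ) ≠ 0 := by exact_mod_cast hp.ne_zero
  have h2 : (n : ℚ) * p = 1 := by rw [hn, inv_mul_cancel₀ hp0]
  have h3 : n * (p : ℤ) = 1 := by exact_mod_cast h2
  have h4 := Int.eq_one_or_neg_one_of_mul_eq_one' h3
  have h5 : (2 : ℤ) ≤ p := by exact_mod_cast hp.two_le
  omega

/-! ### Units `≡ 1 (mod p)` of a CM field are real -/

section CMUnits

variable {L : Type*} [Field L] [NumberField L] [IsCMField L]

/-- Coercion: `unitsComplexConj` is complex conjugation on the underlying field element. -/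
theorem coe_unitsComplexConj (u : (𝓞 L)ˣ) :
    (((IsCMField.unitsComplexConj L u : (𝓞 L)ˣ) : 𝓞 L) : L) = IsCMField.complexConj L ((u : 𝓞 L) : L) := rfl

/-- **For a unit `u ≡ 1 (mod p)` of a CM field, `p` a rational prime not dividing the number of roots of
unity, `ū = u`.** -/
theorem unitsComplexConj_eq_self_of_sub_one_mem {p : ℕ} (hp : p.Prime) (hpN : ¬ p ∣ torsionOrder L)
    (u : (𝓞 L)ˣ) (hu : (u : 𝓞 L) - 1 ∈ Ideal.span {(p : 𝓞 L)}) :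
    IsCMField.unitsComplexConj L u = u := by
  -- a prime `𝔓 ⊇ (p)` of `𝓞 L`; it does not contain `N = torsionOrder L`
  obtain ⟨𝔓, h𝔓max, hp𝔓⟩ := Ideal.exists_le_maximal (Ideal.span {(p : 𝓞 L)})
    (fun htop => not_isUnit_natCast_ringOfIntegers (L := L) hp (Ideal.span_singleton_eq_top.mp htop))
  haveI := h𝔓max.isPrime
  have hpmem : (p : 𝓞 L) ∈ 𝔓 := hp𝔓 (Ideal.subset_span rfl)
  have hN : (torsionOrder L : 𝓞 L) ∉ 𝔓 := by
    intro hN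
    have hcop : IsCoprime (p : 𝓞 L) (torsionOrder L : 𝓞 L) := by
      have h := (Nat.isCoprime_iff_coprime.mpr ((Nat.Prime.coprime_iff_not_dvd hp).mpr hpN)).map
        (Int.castRingHom (𝓞 L))
      simpa using h
    obtain ⟨a, b, hab⟩ := hcop
    exact h𝔓max.ne_top ((Ideal.eq_top_iff_one _).mpr (hab ▸ 𝔓.add_mem (𝔓.mul_mem_left a hpmem) (𝔓.mul_mem_left b hN)))
  -- `u ≡ 1` and `ū ≡ 1 (mod 𝔓)`
  set cR : 𝓞 L ≃+* 𝓞 L := RingOfIntegers.mapRingEquiv (IsCMField.complexConj L).toRingEquiv with hcR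
  have hv : ((IsCMField.unitsComplexConj L u : (𝓞 L)ˣ) : 𝓞 L) = cR (u : 𝓞 L) := rfl
  have hu𝔓 : (u : 𝓞 L) - 1 ∈ 𝔓 := hp𝔓 hu
  have hv𝔓 : cR (u : 𝓞 L) - 1 ∈ 𝔓 := by
    obtain ⟨y, hy⟩ := Ideal.mem_span_singleton'.mp hu
    apply hp𝔓
    rw [Ideal.mem_span_singleton']
    refine ⟨cR y, ?_⟩
    have : cR ((u : 𝓞 L) - 1) = cR (u : 𝓞 L) - 1 := by rw [map_sub, map_one]
    rw [← this, ← hy, map_mul, map_natCast]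
  -- the root of unity `ζ = u ū⁻¹` is `≡ 1 (mod 𝔓)`, hence `= 1`
  set ζ : (𝓞 L)ˣ := (IsCMField.unitsMulComplexConjInv L u : (𝓞 L)ˣ) with hζdef
  have hζu : ζ * IsCMField.unitsComplexConj L u = u := by
    rw [hζdef, IsCMField.unitsMulComplexConjInv_apply, inv_mul_cancel_right]
  have hζN : ((ζ : 𝓞 L)) ^ torsionOrder L = 1 := by
    have hmem : ζ ∈ rootsOfUnity (torsionOrder L) (𝓞 L) := by
      rw [rootsOfUnity_eq_torsion]; exact (IsCMField.unitsMulComplexConjInv L u).2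
    exact (mem_rootsOfUnity' _ ζ).mp hmem
  have hζ1 : (ζ : 𝓞 L) - 1 ∈ 𝔓 := by
    have hprod : ((ζ : 𝓞 L) - 1) * cR (u : 𝓞 L) = ((u : 𝓞 L) - 1) - (cR (u : 𝓞 L) - 1) := by
      have := congrArg (fun x : (𝓞 L)ˣ => (x : 𝓞 L)) hζu
      simp only [Units.val_mul] at this
      rw [hv] at this
      linear_combination this
    have hmem : ((ζ : 𝓞 L) - 1) * cR (u : 𝓞 L) ∈ 𝔓 := hprod ▸ 𝔓.sub_mem hu𝔓 hv𝔓
    rcases h𝔓max.isPrime.mem_or_mem hmem with h | h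
    · exact h
    · exfalso
      have hunit : IsUnit (cR (u : 𝓞 L)) := (Units.isUnit u).map cR
      exact h𝔓max.ne_top (𝔓.eq_top_of_isUnit_mem h hunit)
  have hζone : (ζ : 𝓞 L) = 1 := eq_one_of_pow_eq_one_of_sub_one_mem hζN 𝔓 hζ1 hN
  have hζone' : ζ = 1 := Units.ext hζone
  rw [hζone', one_mul] at hζu
  exact hζu

/-- `(z/|z|)^m = 1` for `z` real, non-zero and `m` even; and `|z|^{0·i} = 1`. -/
theorem archUnitaryValue_eq_one_of_conj_eq {m : ℤ} (hm : Even m) {z : ℂ} (hz0 : z ≠ 0) (hz : conj z = z) :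
    archUnitaryValue m 0 z = 1 := by
  obtain ⟨r, rfl⟩ := hm
  have hn0 : (‖z‖ : ℂ) ≠ 0 := by exact_mod_cast (norm_ne_zero_iff.mpr hz0)
  have hx0 : z / (‖z‖ : ℂ) ≠ 0 := div_ne_zero hz0 hn0
  have hsq : z / (‖z‖ : ℂ) * (z / (‖z‖ : ℂ)) = 1 := by
    have hnorm : (‖z‖ : ℂ) * (‖z‖ : ℂ) = z * z := by
      rw [← sq, ← Complex.ofReal_pow, ← Complex.normSq_eq_norm_sq, ← Complex.mul_conj, hz]
    field_simp
    rw [sq, sq, hnorm]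
  rw [archUnitaryValue, zpow_add₀ hx0, ← mul_zpow, hsq, one_zpow, one_mul, Complex.ofReal_zero, zero_mul,
    Complex.cpow_zero]

/-- **Every CM field has unitary Hecke characters of every even unitary archimedean type `(m, 0)`**
(Weil's extension lemma, tree theorem `HeckeCharacter.exists_isUnitary_hasUnitaryArchType_of_congruence`,
with the congruence subgroup `u ≡ 1 (mod p)` for a prime `p > #μ(L)`). -/
theorem exists_heckeCharacter_even_archType (m : InfinitePlace L → ℤ) (hm : ∀ w, Even (m w)) :
    ∃ ψ : HeckeCharacter L, ψ.IsUnitary ∧ ψ.HasUnitaryArchType m 0 := by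
  obtain ⟨p, hNp, hp⟩ := Nat.exists_infinite_primes (torsionOrder L + 1)
  have hpN : ¬ p ∣ torsionOrder L := fun hdvd =>
    absurd (Nat.le_of_dvd (torsionOrder_pos L) hdvd) (by omega)
  have hp0 : (p : 𝓞 L) ≠ 0 := by exact_mod_cast hp.ne_zero
  refine HeckeCharacter.exists_isUnitary_hasUnitaryArchType_of_congruence m 0
    (𝔞 := Ideal.span {(p : 𝓞 L)}) (by rwa [Ne, Ideal.span_singleton_eq_bot]) fun u hu => ?_
  have hreal := unitsComplexConj_eq_self_of_sub_one_mem hp hpN u hu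
  refine Finset.prod_eq_one fun w _ => ?_
  have hz : conj (w.embedding ((u : 𝓞 L) : L)) = w.embedding ((u : 𝓞 L) : L) := by
    rw [← IsCMField.complexEmbedding_complexConj, ← coe_unitsComplexConj, hreal]
  have hz0 : w.embedding ((u : 𝓞 L) : L) ≠ 0 :=
    (_root_.map_ne_zero _).mpr (by exact_mod_cast (Units.ne_zero u))
  exact archUnitaryValue_eq_one_of_conj_eq (hm w) hz0 hz

end CMUnits

/-! ### The character `ψ` of `E` -/

variable {f : ℤ[X]} (h : IsSepQuartic f)

/-- **Stage B1.**  For `f` as in the route decl (degree `4`, `12 ∣ #Gal`, four real roots) and every even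
`m : InfinitePlace E → ℤ`, the cubic resolvent field `E` carries a unitary Hecke character of unitary
archimedean type `(m, 0)`. -/
theorem exists_psi (h12 : 12 ∣ Nat.card (G f)) (hdeg : f.natDegree = 4)
    (hreal : (f.map (Int.castRingHom ℝ)).roots.card = 4) (m : InfinitePlace (E h) → ℤ) (hm : ∀ w, Even (m w)) :
    ∃ ψ : HeckeCharacter (E h), ψ.IsUnitary ∧ ψ.HasUnitaryArchType m 0 := by
  haveI := isCMField_E h h12 hdeg hreal
  exact exists_heckeCharacter_even_archType m hm

end Summit.Langlands.Langlands.Theorems.ResidualAutomorphyEven
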